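import Literature.Claims.NS.Siche2026
import HarnessLib

/-!
# C135 `Siche2026` — lattice shells: `#S_{25^j} ≥ j + 1` (unbounded) and `#S_{4^a} ≤ 6`

Two elementary facts about the typed shells `S_K = {k ∈ ℤ³ : |k|² = K}` of
`Literature.Claims.NS.Siche2026`:

* the points `5^{j-a}·(p_a, q_a, 0)`, `p_a + i q_a = (3 + 4i)^a`, `0 ≤ a ≤ j`, are `j + 1` distinct points
  of `S_{25^j}` (distinct because `5 ∤ p_a`), so `N_{25^j} = 2·#S_{25^j} ≥ 2(j + 1)` is unbounded along the
  squares `25^j = (5^j)²` — the shells carrying the streamwise modes `5^j e₀`;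
* `x² + y² + z² = 4^a` forces `{x, y, z} = {±2^a, 0, 0}` (descent mod 4), so `#S_{4^a} ≤ 6`, `N_{4^a} ≤ 12`.

WHAT THIS IS NOT: not a claim about NS regularity or blow-up; not a claim about any author beyond the
typed locator.
-/

set_option linter.dupNamespace false

namespace Summit.NavierStokesRegularity.NavierStokesRegularity.Theorems.Siche2026

open Literature.Claims.NS.Siche2026

/-! ## `#S_{25^j} ≥ j + 1` -/

/-- `(p_a, q_a)` with `p_a + i q_a = (3 + 4i)^a`. -/
def gauss : ℕ → ℤ × ℤ
  | 0 => (1, 0)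
  | a + 1 => (3 * (gauss a).1 - 4 * (gauss a).2, 4 * (gauss a).1 + 3 * (gauss a).2)

/-- `p_a² + q_a² = 25^a` (norm multiplicativity of `(3 + 4i)^a`). [folklore] -/
theorem gauss_normSq (a : ℕ) : (gauss a).1 ^ 2 + (gauss a).2 ^ 2 = 25 ^ a := by
  induction a with
  | zero => simp [gauss]
  | succ a ih => simp only [gauss, pow_succ]; nlinarith [ih]

/-- `p_a ≡ 1` or `3 (mod 5)`: `(p_a, q_a) ≡ (3, 4) (mod 5)` for `a ≥ 1`. [folklore] -/
theorem gauss_mod_five (a : ℕ) : (gauss a).1 % 5 = 1 ∨ (gauss a).1 % 5 = 3 := by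
  suffices h : ∀ a, 1 ≤ a → (gauss a).1 % 5 = 3 ∧ (gauss a).2 % 5 = 4 by
    rcases Nat.eq_zero_or_pos a with rfl | ha
    · left; simp [gauss]
    · exact Or.inr (h a ha).1
  intro a ha
  induction a with
  | zero => omega
  | succ a ih =>
    rcases Nat.eq_zero_or_pos a with rfl | ha'
    · simp [gauss]
    · obtain ⟨h1, h2⟩ := ih ha'
      simp only [gauss]
      omega

/-- `5 ∤ p_a`. [folklore] -/
theorem five_not_dvd_gauss (a : ℕ) : ¬ (5 : ℤ) ∣ (gauss a).1 := by
  intro h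
  rcases gauss_mod_five a with h' | h' <;> omega

/-- the `a`-th point of the shell `25^j`: `5^{j-a} (p_a, q_a, 0)`. -/
def shellPoint (j a : ℕ) : Z3 := ![5 ^ (j - a) * (gauss a).1, 5 ^ (j - a) * (gauss a).2, 0]

/-- the points `5^{j-a}(p_a, q_a, 0)`, `a ≤ j`, lie on the shell `25^j`. [folklore] -/
theorem shellPoint_mem {j a : ℕ} (ha : a ≤ j) : shellPoint j a ∈ shell (25 ^ j) := by
  unfold shell
  have hnorm : latticeNormSq (shellPoint j a) = (25 : ℤ) ^ j := by
    simp only [latticeNormSq, Fin.sum_univ_three, shellPoint, Matrix.cons_val_zero, Matrix.cons_val_one,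
      Matrix.cons_val]
    have h25 : (25 : ℤ) ^ j = 25 ^ (j - a) * 25 ^ a := by rw [← pow_add, Nat.sub_add_cancel ha]
    rw [h25, ← gauss_normSq a, show (25 : ℤ) ^ (j - a) = (5 ^ (j - a)) ^ 2 by rw [← pow_mul, mul_comm, pow_mul]; norm_num]
    ring
  rw [Finset.mem_filter, Fintype.mem_piFinset]
  refine ⟨fun i => Finset.mem_Icc.2 ?_, by rw [hnorm]; push_cast; ring⟩
  have hi : shellPoint j a i ^ 2 ≤ (25 : ℤ) ^ j := by
    rw [← hnorm]
    unfold latticeNormSq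
    rw [Fin.sum_univ_three]
    fin_cases i <;> simp <;> nlinarith [sq_nonneg (shellPoint j a 0), sq_nonneg (shellPoint j a 1),
      sq_nonneg (shellPoint j a 2)]
  push_cast
  constructor <;> nlinarith [sq_nonneg (shellPoint j a i - 1), sq_nonneg (shellPoint j a i + 1),
    pow_pos (show (0:ℤ) < 25 by norm_num) j]

/-- the points `5^{j-a}(p_a, q_a, 0)`, `a ≤ j`, are distinct (5-adic valuation of the first coordinate). [folklore] -/
theorem shellPoint_injOn (j : ℕ) : Set.InjOn (shellPoint j) (Finset.range (j + 1) : Set ℕ) := by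
  intro a ha b hb hab
  simp only [Finset.coe_range, Set.mem_Iio] at ha hb
  have h0 : (5 : ℤ) ^ (j - a) * (gauss a).1 = 5 ^ (j - b) * (gauss b).1 := by
    have := congrFun hab 0; simpa [shellPoint] using this
  by_contra hne
  rcases lt_or_gt_of_ne hne with hlt | hlt
  · -- a < b: 5^(j-a) = 5^(j-b) * 5^(b-a)
    have hsplit : (5 : ℤ) ^ (j - a) = 5 ^ (j - b) * 5 ^ (b - a) := by
      rw [← pow_add]; congr 1; omega
    rw [hsplit, mul_assoc] at h0
    have h5 : (gauss b).1 = 5 ^ (b - a) * (gauss a).1 :=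
      (mul_left_cancel₀ (pow_ne_zero _ (by norm_num)) h0).symm
    apply five_not_dvd_gauss b
    rw [h5, show b - a = (b - a - 1) + 1 by omega, pow_succ]
    exact Dvd.dvd.mul_right (dvd_mul_left _ _) _
  · have hsplit : (5 : ℤ) ^ (j - b) = 5 ^ (j - a) * 5 ^ (a - b) := by
      rw [← pow_add]; congr 1; omega
    rw [hsplit, mul_assoc] at h0
    have h5 : (gauss a).1 = 5 ^ (a - b) * (gauss b).1 :=
      mul_left_cancel₀ (pow_ne_zero _ (by norm_num)) h0
    apply five_not_dvd_gauss a
    rw [h5, show a - b = (a - b - 1) + 1 by omega, pow_succ]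
    exact Dvd.dvd.mul_right (dvd_mul_left _ _) _

/-- **`#S_{25^j} ≥ j + 1`**. -/
theorem succ_le_card_shell (j : ℕ) : j + 1 ≤ (shell (25 ^ j)).card := by
  classical
  calc j + 1 = (Finset.range (j + 1)).card := (Finset.card_range _).symm
    _ = ((Finset.range (j + 1)).image (shellPoint j)).card :=
        (Finset.card_image_of_injOn (shellPoint_injOn j)).symm
    _ ≤ (shell (25 ^ j)).card := Finset.card_le_card fun k hk => by
        obtain ⟨a, ha, rfl⟩ := Finset.mem_image.1 hk
        exact shellPoint_mem (by rw [Finset.mem_range] at ha; omega)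

/-- **the mode numbers `N_{25^j}` are unbounded**: for every real `C` there is `j ≥ 1` with
`C < #S_{25^j} ≤ N_{25^j}/2`. -/
theorem exists_shell_card_gt (C : ℝ) : ∃ j : ℕ, 1 ≤ j ∧ C < ((shell (25 ^ j)).card : ℝ) := by
  obtain ⟨m, hm⟩ := exists_nat_gt C
  refine ⟨m + 1, by omega, hm.trans_le ?_⟩
  exact_mod_cast (Nat.le_succ_of_le (Nat.le_succ m)).trans (succ_le_card_shell (m + 1))

/-! ## `#S_{4^a} ≤ 6` -/

/-- `x² + y² + z² ≡ 0 (mod 4)` forces `x, y, z` even. [folklore] -/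
theorem even_of_sum_sq_emod_four {x y z : ℤ} (h : (x ^ 2 + y ^ 2 + z ^ 2) % 4 = 0) :
    2 ∣ x ∧ 2 ∣ y ∧ 2 ∣ z := by
  have hsq : ∀ s : ℤ, s ^ 2 % 4 = 0 ∨ s ^ 2 % 4 = 1 := fun s => by
    rcases Int.even_or_odd s with ⟨k, rfl⟩ | ⟨k, rfl⟩ <;> ring_nf <;> omega
  have hx := hsq x; have hy := hsq y; have hz := hsq z
  have ex : x ^ 2 % 4 = 0 := by omega
  have ey : y ^ 2 % 4 = 0 := by omega
  have ez : z ^ 2 % 4 = 0 := by omega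
  refine ⟨?_, ?_, ?_⟩
  · by_contra hc
    obtain ⟨w, rfl⟩ : ∃ w, x = 2 * w + 1 := ⟨x / 2, by omega⟩
    ring_nf at ex; omega
  · by_contra hc
    obtain ⟨w, rfl⟩ : ∃ w, y = 2 * w + 1 := ⟨y / 2, by omega⟩
    ring_nf at ey; omega
  · by_contra hc
    obtain ⟨w, rfl⟩ : ∃ w, z = 2 * w + 1 := ⟨z / 2, by omega⟩
    ring_nf at ez; omega

/-- `x² + y² + z² = 1` on `ℤ³`: the six unit vectors. [folklore] -/
theorem sum_sq_eq_one {x y z : ℤ} (h : x ^ 2 + y ^ 2 + z ^ 2 = 1) :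
    (x = 1 ∨ x = -1) ∧ y = 0 ∧ z = 0 ∨ x = 0 ∧ (y = 1 ∨ y = -1) ∧ z = 0 ∨
      x = 0 ∧ y = 0 ∧ (z = 1 ∨ z = -1) := by
  have hx : x ^ 2 ≤ 1 := by nlinarith [sq_nonneg y, sq_nonneg z]
  have hy : y ^ 2 ≤ 1 := by nlinarith [sq_nonneg x, sq_nonneg z]
  have hz : z ^ 2 ≤ 1 := by nlinarith [sq_nonneg x, sq_nonneg y]
  have hx1 : -1 ≤ x := by nlinarith
  have hx2 : x ≤ 1 := by nlinarith
  have hy1 : -1 ≤ y := by nlinarith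
  have hy2 : y ≤ 1 := by nlinarith
  have hz1 : -1 ≤ z := by nlinarith
  have hz2 : z ≤ 1 := by nlinarith
  interval_cases x <;> interval_cases y <;> interval_cases z <;> simp_all

/-- descent: `x² + y² + z² = 4^a` forces one coordinate `±2^a` and the others `0`. -/
theorem sum_sq_eq_four_pow {a : ℕ} {x y z : ℤ} (h : x ^ 2 + y ^ 2 + z ^ 2 = 4 ^ a) :
    (x = 2 ^ a ∨ x = -2 ^ a) ∧ y = 0 ∧ z = 0 ∨ x = 0 ∧ (y = 2 ^ a ∨ y = -2 ^ a) ∧ z = 0 ∨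
      x = 0 ∧ y = 0 ∧ (z = 2 ^ a ∨ z = -2 ^ a) := by
  induction a generalizing x y z with
  | zero => simpa using sum_sq_eq_one (by simpa using h)
  | succ a ih =>
    have h4 : (x ^ 2 + y ^ 2 + z ^ 2) % 4 = 0 := by rw [h, pow_succ]; simp
    obtain ⟨⟨x', rfl⟩, ⟨y', rfl⟩, ⟨z', rfl⟩⟩ := even_of_sum_sq_emod_four h4
    have h' : x' ^ 2 + y' ^ 2 + z' ^ 2 = 4 ^ a := by
      have : (4 : ℤ) ^ (a + 1) = 4 * 4 ^ a := by ring
      nlinarith [h]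
    rcases ih h' with ⟨hx, hy, hz⟩ | ⟨hx, hy, hz⟩ | ⟨hx, hy, hz⟩
    · left; refine ⟨?_, by simp [hy], by simp [hz]⟩
      rcases hx with rfl | rfl <;> [left; right] <;> ring
    · right; left; refine ⟨by simp [hx], ?_, by simp [hz]⟩
      rcases hy with rfl | rfl <;> [left; right] <;> ring
    · right; right; refine ⟨by simp [hx], by simp [hy], ?_⟩
      rcases hz with rfl | rfl <;> [left; right] <;> ring

/-- **`#S_{4^a} ≤ 6`**, hence `N_{4^a} ≤ 12`. -/
theorem card_shell_four_pow_le (a : ℕ) : (shell (4 ^ a)).card ≤ 6 := by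
  classical
  set P : Finset Z3 := {![2 ^ a, 0, 0], ![-2 ^ a, 0, 0], ![0, 2 ^ a, 0], ![0, -2 ^ a, 0],
    ![0, 0, 2 ^ a], ![0, 0, -2 ^ a]} with hP
  have hsub : shell (4 ^ a) ⊆ P := by
    intro k hk
    unfold shell at hk
    rw [Finset.mem_filter] at hk
    have h : k 0 ^ 2 + k 1 ^ 2 + k 2 ^ 2 = 4 ^ a := by
      have := hk.2; unfold latticeNormSq at this; rw [Fin.sum_univ_three] at this; exact_mod_cast this
    have hk3 : k = ![k 0, k 1, k 2] := by ext i; fin_cases i <;> rfl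
    rw [hP, hk3]
    simp only [Finset.mem_insert, Finset.mem_singleton]
    rcases sum_sq_eq_four_pow h with ⟨hx, hy, hz⟩ | ⟨hx, hy, hz⟩ | ⟨hx, hy, hz⟩
    · rcases hx with hx | hx <;> simp [hx, hy, hz]
    · rcases hy with hy | hy <;> simp [hx, hy, hz]
    · rcases hz with hz | hz <;> simp [hx, hy, hz]
  refine (Finset.card_le_card hsub).trans ?_
  rw [hP]
  refine (Finset.card_insert_le _ _).trans ?_
  refine Nat.succ_le_succ ((Finset.card_insert_le _ _).trans ?_)
  refine Nat.succ_le_succ ((Finset.card_insert_le _ _).trans ?_)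
  refine Nat.succ_le_succ ((Finset.card_insert_le _ _).trans ?_)
  refine Nat.succ_le_succ ((Finset.card_insert_le _ _).trans ?_)
  rw [Finset.card_singleton]

/-- `N_{4^a} ≤ 12`. [folklore] -/
theorem shellModes_four_pow_le (a : ℕ) : (shellModes (4 ^ a) : ℝ) ≤ 12 := by
  unfold shellModes
  have := card_shell_four_pow_le a
  exact_mod_cast (by omega : 2 * (shell (4 ^ a)).card ≤ 12)

end Summit.NavierStokesRegularity.NavierStokesRegularity.Theorems.Siche2026
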